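import Literature.MathematicalPhysics.QuantumFieldTheory.Balaban1983to89.B8Prop6CubeMemberScalarBdryBetaOfGBound
import Literature.MathematicalPhysics.QuantumFieldTheory.Balaban1983to89.B8Prop6CubeMemberScalarGamma
import Literature.MathematicalPhysics.QuantumFieldTheory.Balaban1983to89.B8Thm32GBoundCubeMember

/-!
# `Balaban1983to89.B8Prop6CubeMemberScalarGammaOfGBound` — [Balaban1985RegularSpaces] PROPOSITION 6 (p. 99) AT A CUBE OF PRINT'S BIG-BLOCK SUB-LATTICE FROM
# THE TWO SCALAR FLAT γ CLAUSES AND THE 𝒢-BOUND ([Balaban1985BackgroundPropagators] THEOREM 3.2) — the flat p6 letter's three REAL families DISCHARGED BY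
# NAME (dag-n05-c F8 ∕ F10) — EDITION γ

statement-level skeleton of published theorems with citation tags; proofs where landed; nothing here is a claim about the
Yang–Mills mass gap

PDF held: `paper:balaban1985-cmp99-regular-spaces-gauge-fixing`; pp. 98–99 (Prop. 6, the cubes), pp. 86–87, (1.91)–(1.92) p. 91, (1.98) p. 92, (1.101) p. 93.
[4] = `[Balaban1985BackgroundPropagators]` Thms 3.1–3.3 pp. 397–399; [B6] = `[Balaban1984PropagatorsII]` Prop. 2.3 p. 238.

CITATION HEADER (lean-in-tree rule).  Cell `pub-ymgap` (HUMAN RULING D-0062, Track A), DAG node N05 = [B8], seat `pub-ymgap-dag-n05-e` g10 (R141 (C) row s3b —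
the FLAT line of Proposition 6's cube road, edition γ; file Fγ8).  WHY THIS FILE.  g9's `B8Prop6CubeMemberScalarBdryBetaOfGBound` (p563641) discharged the flat
letter's three REAL binders by dag-n05-c's `B8Prop6CubeMemberRealOfGBound.prop6_real123_of_gbound_printed` (F8) ∕ `B8Thm32GBoundCubeMember.GBoundCubeMemberPrinted`
(F10) on print's big-block sub-lattice — in edition β (VACUOUS at cube members, p572834).  EDITION γ: the same composition on Fγ7's
`B8Prop6CubeMemberScalarGamma.gaugedBoundB8_cubeMember_scalar_γ` (scalar clauses over the split print class `cubeLamBP'`).  ★ `gaugedBoundB8_cubeMember_scalar_γ_of_gboundAt`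
(𝒢-bound displayed per cube with any constant), ★ `gaugedBoundB8_cubeMember_scalar_γ_of_GBound (hG : GBoundCubeMemberPrinted (d − 1) (L − 1))` (named;
conditional).  Proofs = p563641's.  Kind «kernel-checked proof», theorems only, no `def`.

HONEST SCOPE ∕ A6.  Per cube: SC4γ + SC2γ (scalar (1.59) γ clauses — print's (1.59) at `U₀ = 1` over print's class, named `Ineq159FlatCubeMemberPrinted`, OPEN;
INHABITED per cube by dag-n05-w3 p585691 via `B8Ineq159FlatCubeMemberSCGamma`) and the 𝒢-bound ([4] Thm 3.2 at `U = 1`; PROVED by dag-n05-c G3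
`gBoundCubeMemberPrinted_of_one_le`, consumed in Fγ9).  Print's p. 98 side conditions displayed; LOCATED-CARRIER (NODE 00's `CubeB8` ⊋ print's cubes) applies:
no family-level claim over all cubes.  Nothing of [4] proved here.  Count-neutral; N05 NOT discharged; one finite `𝕋⁴` programme at fixed `ε`, Bałaban as printed; nothing continuum ∕ ℝ⁴ ∕ OS ∕ mass-gap ∕ Clay.  No `sorry`, no
`def`, no `instance`, no `notation`.  Unit `pub-ymgap-dag-n05-e` (g10), 2026-08-28.
-/

noncomputable section

open NormedSpace

namespace Literature.MathematicalPhysics.QuantumFieldTheory.Balaban1983to89.B8Prop6CubeMemberScalarGammaOfGBound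

open scoped Matrix
open MatrixLog B7Prop1Explicit B7Prop2Explicit B7Prop1Local B7Eq92Concrete
open B7Prop4GeneralLevels (logCovIter linCovIter)
open B8Ineq132 (covDerivFwd InAk BondTouches)
open B8Eq140Level (SideTouches)
open B8Eq143PlaqExpansion (pdiv)
open B8Eq146AExpansion (iEta plaqCovDeriv)
open B8Eq155JBound (Jcur wsup)
open B8ScaledSupNorm (bondNorm msup)
open B8Eq138LandauZd (IsLandau138 covLap)
open B8LambdaSpaceKLevel (wt)
open B8Eq131CubesAdmissible (cubeFam)
open B8CubeMemberZd (cubeLamS cubeLamB)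
open B9SupplySockB9P3ZdBeta (CrossB)
open B8Eq1101CubeMemberWeights (wPrinted wPrinted_facts)
open B8Prop6CubeMemberRealOfGBound (prop6_real123_of_gbound_printed)
open B8Thm32GBoundCubeMember (GBoundCubeMemberPrinted prop6_real123_printed_of_GBound)
open B8Prop6CubeMemberScalarGamma (gaugedBoundB8_cubeMember_scalar_γ)
open B9SupplySockB9P3ZdGamma (cubeLamBP')
open Node00 (CubeB8 GaugedBoundB8)
open Literature.MathematicalPhysics.QuantumLattice (blockMap)

export B7Prop1Explicit (Site)

variable {d : ℕ}

variable {𝔸 : Type} [CStarAlgebra 𝔸] [Nontrivial 𝔸]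

/-! ## §1 Proposition 6 at a sub-lattice cube from the scalar γ clauses + the 𝒢-bound displayed at the cube's data -/

open Classical in
/-- ★ **PROPOSITION 6 (p. 99), (1.135)–(1.138) AS `Node00.GaugedBoundB8` AT A CUBE OF PRINT'S BIG-BLOCK SUB-LATTICE, FROM THE TWO SCALAR FLAT γ CLAUSES
AND THE 𝒢-BOUND DISPLAYED AT THE CUBE'S DATA** — p557429's `gaugedBoundB8_cubeMember_scalar_γ` with its weights instantiated at dag-n05-c's printed
weights `wPrinted (d−1) (L−1) η` and its three REAL inequality families DISCHARGED by dag-n05-c's `prop6_real123_of_gbound_printed` (F8: REAL-1 ∕ REAL-1′ kernel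
theorems + algebra) from the 𝒢-bound `wt(j_p)⁴·L^{−dj_p}·|((QT⁻¹T⁻¹Qᵀ)⁻¹X)_p| ≤ C_𝒢·sup|X|` ([4] Theorem 3.2 (3.48) at `U = 1`, row-summed) at every truncation
`1 ≤ n ≤ k` of that cube; print's p. 98 side conditions on the cube datum («M is a multiple of R₁M₁ … □_j a sum of the big blocks», `(R₁, M₁) ↔ (R, M_h)` above
the thresholds `ρ₀, M₀, N₀` «for which all the theorems of [2, 4] are valid») displayed as hypotheses.  Any `C_𝒢 ≥ 0`; `c₁` depends on it.
[cite: Balaban1985RegularSpaces, Prop. 6 (1.135)–(1.138) p.99, p.98, Thm 4 p.88, Prop. 3 p.87, (1.59) p.86, (1.31) p.82, (1.91)–(1.92) p.91, (1.98) p.92, (1.101) p.93; Balaban1985BackgroundPropagators, Thm 3.2 (3.48) p.398, Thm 3.1 (3.47) p.398, Thm 3.3 p.399] -/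
theorem gaugedBoundB8_cubeMember_scalar_γ_of_gboundAt (hd2 : 2 ≤ d) {L : ℕ} (hL : 2 ≤ L) {B₀ Bbd CG : ℝ} (hB₀ : 0 < B₀)
    (hB : 2 ≤ 5 * (d : ℝ) * L * B₀) (hBbd : 0 ≤ Bbd) (hBd : 4 * Bbd ≤ ((d : ℝ) * L - 1) * B₀) (hCG : 0 ≤ CG) :
    ∃ c₁ ρ₀ M₀ : ℝ, ∃ N₀ : ℕ, 0 < c₁ ∧ ∀ (η : ℝ), 0 < η → ∀ {K : ℕ} {Ω : ℕ → Set (Site d)} (c : CubeB8 d L K Ω),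
      -- PRINT'S SIDE CONDITIONS (p. 98) on the cube datum, above threshold: big blocks `M_hL`, `ρ ≥ R·M_hL`, `M_hL ∣ ρ`, `M_hL ∣ M`
      ∀ (Mh R : ℕ), 3 ≤ Mh → M₀ ≤ (L : ℝ) * Mh → Mh * L ∣ c.ρ → Mh * L ∣ c.M → R * (Mh * L) ≤ c.ρ → 2 * L ≤ R →
        N₀ + 1 ≤ R * (L * Mh) → ρ₀ ≤ (c.ρ : ℝ) →
      -- THE SCALAR FLAT FOUR-LINE (1.59) CLAUSE OF PROPOSITION 3's FRAME at the cube's top truncation `c.k`: ℂ-valued bond functions in the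
      -- flat Landau gauge on the collars of `{□_j}`, exterior-collar allowance on each line ([4] Thm 3.3 at `U = 1` for `G(1)`, `H(1)`, a priori)
      (∀ φ : Site d → Fin d → ℂ,
        IsLandau138 L c.k η (cubeFam false L c.a c.M c.ρ c.k 0) (cubeLamS L c.a c.M c.ρ c.k c.k) (1 : Site d → Fin d → ℂˣ) φ →
        (∀ (y : Site d) (τ : Fin d), (∀ j, j ≤ c.k → ¬ SideTouches (cubeFam false L c.a c.M c.ρ c.k j) y τ) → φ y τ = 0) →
        msup L c.k η (-(1 : ℝ)) (fun j (b : Site d × Fin d) => SideTouches (cubeFam false L c.a c.M c.ρ c.k j) b.1 b.2) (fun b => φ b.1 b.2)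
          ≤ B₀ * (bondNorm L c.k η (-(3 : ℝ)) (cubeFam false L c.a c.M c.ρ c.k) (fun x μ => Jcur η (1 : Site d → Fin d → ℂˣ) φ μ x)
            + wsup 1 (fun p : {p : ℕ × (Site d × Fin d) // p.1 ≤ c.k ∧ (p.2 ∈ cubeLamBP' L c.a c.M c.ρ c.k c.k p.1 ∨ (p.1 = 0 ∧ CrossB ((cubeFam false L c.a c.M c.ρ c.k) 0) p.2))} =>
                linCovIter L (1 : Site d → Fin d → ℂˣ) (iEta η φ) p.1.1 p.1.2.1 p.1.2.2))
            + Bbd * msup L c.k η (-(1 : ℝ)) (fun j (b : Site d × Fin d) => j = 0 ∧ SideTouches (cubeFam false L c.a c.M c.ρ c.k 0) b.1 b.2 ∧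
                ¬ BondTouches (cubeFam false L c.a c.M c.ρ c.k 0) b.1 b.2) (fun b => φ b.1 b.2) ∧
        msup L c.k η (-(2 : ℝ)) (fun j (t : Fin d × Fin d × Site d) => SideTouches (cubeFam false L c.a c.M c.ρ c.k j) t.2.2 t.2.1)
            (fun t => covDerivFwd η (1 : Site d → Fin d → ℂˣ) t.1 (fun z => φ z t.2.1) t.2.2)
          ≤ B₀ * (bondNorm L c.k η (-(3 : ℝ)) (cubeFam false L c.a c.M c.ρ c.k) (fun x μ => Jcur η (1 : Site d → Fin d → ℂˣ) φ μ x)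
            + wsup 1 (fun p : {p : ℕ × (Site d × Fin d) // p.1 ≤ c.k ∧ (p.2 ∈ cubeLamBP' L c.a c.M c.ρ c.k c.k p.1 ∨ (p.1 = 0 ∧ CrossB ((cubeFam false L c.a c.M c.ρ c.k) 0) p.2))} =>
                linCovIter L (1 : Site d → Fin d → ℂˣ) (iEta η φ) p.1.1 p.1.2.1 p.1.2.2))
            + Bbd * msup L c.k η (-(1 : ℝ)) (fun j (b : Site d × Fin d) => j = 0 ∧ SideTouches (cubeFam false L c.a c.M c.ρ c.k 0) b.1 b.2 ∧
                ¬ BondTouches (cubeFam false L c.a c.M c.ρ c.k 0) b.1 b.2) (fun b => φ b.1 b.2) ∧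
        bondNorm L c.k η (-(3 : ℝ)) (cubeFam false L c.a c.M c.ρ c.k) (fun x μ => pdiv η (1 : Site d → Fin d → ℂˣ) (plaqCovDeriv η (1 : Site d → Fin d → ℂˣ) φ) μ x)
          ≤ B₀ * (bondNorm L c.k η (-(3 : ℝ)) (cubeFam false L c.a c.M c.ρ c.k) (fun x μ => Jcur η (1 : Site d → Fin d → ℂˣ) φ μ x)
            + wsup 1 (fun p : {p : ℕ × (Site d × Fin d) // p.1 ≤ c.k ∧ (p.2 ∈ cubeLamBP' L c.a c.M c.ρ c.k c.k p.1 ∨ (p.1 = 0 ∧ CrossB ((cubeFam false L c.a c.M c.ρ c.k) 0) p.2))} =>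
                linCovIter L (1 : Site d → Fin d → ℂˣ) (iEta η φ) p.1.1 p.1.2.1 p.1.2.2))
            + Bbd * msup L c.k η (-(1 : ℝ)) (fun j (b : Site d × Fin d) => j = 0 ∧ SideTouches (cubeFam false L c.a c.M c.ρ c.k 0) b.1 b.2 ∧
                ¬ BondTouches (cubeFam false L c.a c.M c.ρ c.k 0) b.1 b.2) (fun b => φ b.1 b.2) ∧
        bondNorm L c.k η (-(3 : ℝ)) (cubeFam false L c.a c.M c.ρ c.k) (fun x μ => covLap η (1 : Site d → Fin d → ℂˣ) (fun z => φ z μ) x)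
          ≤ B₀ * (bondNorm L c.k η (-(3 : ℝ)) (cubeFam false L c.a c.M c.ρ c.k) (fun x μ => Jcur η (1 : Site d → Fin d → ℂˣ) φ μ x)
            + wsup 1 (fun p : {p : ℕ × (Site d × Fin d) // p.1 ≤ c.k ∧ (p.2 ∈ cubeLamBP' L c.a c.M c.ρ c.k c.k p.1 ∨ (p.1 = 0 ∧ CrossB ((cubeFam false L c.a c.M c.ρ c.k) 0) p.2))} =>
                linCovIter L (1 : Site d → Fin d → ℂˣ) (iEta η φ) p.1.1 p.1.2.1 p.1.2.2))
            + Bbd * msup L c.k η (-(1 : ℝ)) (fun j (b : Site d × Fin d) => j = 0 ∧ SideTouches (cubeFam false L c.a c.M c.ρ c.k 0) b.1 b.2 ∧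
                ¬ BondTouches (cubeFam false L c.a c.M c.ρ c.k 0) b.1 b.2) (fun b => φ b.1 b.2)) →
      ∀ (U₀ : Site d → Fin d → 𝔸ˣ), (∀ x κ, U₀ x κ ∈ unitaryUnits 𝔸) → ∀ (α₀ : ℝ), 0 < α₀ → InAk L K η α₀ Ω U₀ →
      7 * d * (L : ℝ) ^ 2 * c.M * α₀ ≤ c₁ →
      -- THE 𝒢-BOUND ([4] Theorem 3.2 (3.48), row-summed) DISPLAYED at this cube's data: every truncation `1 ≤ n ≤ k`, weights `wPrinted`, constant `C_𝒢`
      (∀ n, 1 ≤ n → n ≤ c.k → ∀ (S : Finset (Site d)), (∀ x, x ∈ S ↔ x ∈ cubeFam false L c.a c.M c.ρ c.k 0) →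
        ∀ (B : Finset (ℕ × Site d)), (∀ p, p ∈ B ↔ p.1 ≤ n ∧ p.2 ∈ cubeLamS L c.a c.M c.ρ c.k n p.1) →
        ∀ (K : Site d → Site d → ℝ), (∀ x z, K x z =
          ((η ^ 2)⁻¹ * ∑ μ : Fin d, ((2 : ℝ) * (if z = x then (1 : ℝ) else 0) - (if z = x + e μ then (1 : ℝ) else 0)
            - (if z = x - e μ then (1 : ℝ) else 0))) +
          (∑ j ∈ Finset.range (n + 1), (if blockMap (L ^ j) x ∈ cubeLamS L c.a c.M c.ρ c.k n j ∧ blockMap (L ^ j) z = blockMap (L ^ j) x then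
            wPrinted (d - 1) (L - 1) η j * ((((L : ℝ) ^ d)⁻¹) ^ j) ^ 2 else 0))) →
        ∀ (T : Matrix ↥S ↥S ℝ), T = Matrix.of (fun x z : ↥S => K x.1 z.1) →
        ∀ (Q : Matrix ↥B ↥S ℝ), Q = Matrix.of (fun (p : ↥B) (z : ↥S) =>
          if blockMap (L ^ p.1.1) z.1 = p.1.2 then (((L : ℝ) ^ d)⁻¹) ^ p.1.1 else 0) →
        ∀ (X : ↥B → ℝ) (s : ℝ), 0 ≤ s → (∀ p', |X p'| ≤ s) → ∀ p : ↥B,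
          wt L η p.1.1 ^ 4 * ((((L : ℝ)) ^ d) ^ p.1.1)⁻¹ * |∑ p' : ↥B, (Q * T⁻¹ * T⁻¹ * Qᵀ)⁻¹ p p' * X p'| ≤ CG * s) →
      -- THE SCALAR FLAT TWO-LINE (1.59) CLAUSE OF THEOREM 4's FRAME at every truncation `m ≤ c.k` (ℂ-valued, flat Landau gauge, collar allowance)
      (∀ m, 1 ≤ m → m ≤ c.k → ∀ φ : Site d → Fin d → ℂ,
        IsLandau138 L m η ((cubeFam false L c.a c.M c.ρ c.k) 0) ((cubeLamS L c.a c.M c.ρ c.k) m) (1 : Site d → Fin d → ℂˣ) φ →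
        (∀ (y : Site d) (τ : Fin d), (∀ j, j ≤ m → ¬ SideTouches ((cubeFam false L c.a c.M c.ρ c.k) j) y τ) → φ y τ = 0) →
        msup L m η (-(1 : ℝ)) (fun j (b : Site d × Fin d) => SideTouches ((cubeFam false L c.a c.M c.ρ c.k) j) b.1 b.2) (fun b => φ b.1 b.2)
          ≤ B₀ * (bondNorm L m η (-(3 : ℝ)) (cubeFam false L c.a c.M c.ρ c.k) (fun x μ => Jcur η (1 : Site d → Fin d → ℂˣ) φ μ x)
            + wsup 1 (fun p : {p : ℕ × (Site d × Fin d) // p.1 ≤ m ∧ (p.2 ∈ (cubeLamBP' L c.a c.M c.ρ c.k) m p.1 ∨ (p.1 = 0 ∧ CrossB ((cubeFam false L c.a c.M c.ρ c.k) 0) p.2))} =>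
                linCovIter L (1 : Site d → Fin d → ℂˣ) (iEta η φ) p.1.1 p.1.2.1 p.1.2.2))
            + Bbd * msup L m η (-(1 : ℝ)) (fun j (b : Site d × Fin d) => j = 0 ∧ SideTouches ((cubeFam false L c.a c.M c.ρ c.k) 0) b.1 b.2 ∧
                ¬ BondTouches ((cubeFam false L c.a c.M c.ρ c.k) 0) b.1 b.2) (fun b => φ b.1 b.2) ∧
        msup L m η (-(2 : ℝ)) (fun j (t : Fin d × Fin d × Site d) => SideTouches ((cubeFam false L c.a c.M c.ρ c.k) j) t.2.2 t.2.1)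
            (fun t => covDerivFwd η (1 : Site d → Fin d → ℂˣ) t.1 (fun z => φ z t.2.1) t.2.2)
          ≤ B₀ * (bondNorm L m η (-(3 : ℝ)) (cubeFam false L c.a c.M c.ρ c.k) (fun x μ => Jcur η (1 : Site d → Fin d → ℂˣ) φ μ x)
            + wsup 1 (fun p : {p : ℕ × (Site d × Fin d) // p.1 ≤ m ∧ (p.2 ∈ (cubeLamBP' L c.a c.M c.ρ c.k) m p.1 ∨ (p.1 = 0 ∧ CrossB ((cubeFam false L c.a c.M c.ρ c.k) 0) p.2))} =>
                linCovIter L (1 : Site d → Fin d → ℂˣ) (iEta η φ) p.1.1 p.1.2.1 p.1.2.2))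
            + Bbd * msup L m η (-(1 : ℝ)) (fun j (b : Site d × Fin d) => j = 0 ∧ SideTouches ((cubeFam false L c.a c.M c.ρ c.k) 0) b.1 b.2 ∧
                ¬ BondTouches ((cubeFam false L c.a c.M c.ρ c.k) 0) b.1 b.2) (fun b => φ b.1 b.2)) →
      GaugedBoundB8 L η U₀ c (7 * d * (L : ℝ) ^ 2 * (5 * (d : ℝ) * L * B₀) * c.M * α₀) := by
  -- write `d = d' + 1`, `L = ℓ + 1` (dag-n05-c's convention)
  obtain ⟨d', rfl⟩ : ∃ d', d = d' + 1 := ⟨d - 1, by omega⟩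
  obtain ⟨ℓ, rfl⟩ : ∃ ℓ, L = ℓ + 1 := ⟨L - 1, by omega⟩
  have hℓ : 1 ≤ ℓ := by omega
  -- dag-n05-c's F8: the three REAL families from the 𝒢-bound, constants depending on `d, ℓ` (and `C_𝒢`)
  obtain ⟨BG, BG', ρ₀, M₀, N₀, hBG, hBG', -, -, F8⟩ := prop6_real123_of_gbound_printed d' ℓ hℓ
  have hB₀'H : 0 < BG * (BG' * CG) + BG := by positivity
  have hB₂' : 0 ≤ BG' * CG + 8 := by positivity
  have hBR : 0 ≤ 1 + ((BG' * CG + 8) + 8) * BG := by positivity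
  have hfree : 3 * (2 * ((d' + 1 : ℕ) : ℝ) * (((ℓ + 1 : ℕ) : ℝ)) ^ 2) * BG * (1 + ((BG' * CG + 8) + 8) * BG) ≤
      3 * (2 * ((d' + 1 : ℕ) : ℝ) * (((ℓ + 1 : ℕ) : ℝ)) ^ 2) * BG * (1 + ((BG' * CG + 8) + 8) * BG) + 1 := by linarith
  have hB₀' : 0 < 3 * (2 * ((d' + 1 : ℕ) : ℝ) * (((ℓ + 1 : ℕ) : ℝ)) ^ 2) * BG * (1 + ((BG' * CG + 8) + 8) * BG) + 1 := by positivity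
  have hC₂ : 2097152 * (((d' + 1 : ℕ) : ℝ) + 1) ^ 2 * (((ℓ + 1 : ℕ) : ℝ)) ^ 2 ≤ 2097152 * (((d' + 1 : ℕ) : ℝ) + 1) ^ 2 * (((ℓ + 1 : ℕ) : ℝ)) ^ 2 :=
    le_rfl
  -- p557429's per-cube letter with these constants
  obtain ⟨c₁, hc₁, G⟩ := gaugedBoundB8_cubeMember_scalar_γ (𝔸 := 𝔸) hd2 hL hB₀ hB₀' hB hC₂ hB₀'H hB₂' hBG.le hBR hfree hBbd hBd
  refine ⟨c₁, ρ₀, M₀, N₀, hc₁, ?_⟩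
  intro η hη K Ω c Mh R hMh hM0 hρd hMd hR hR2 hRN hρ0 SC4 U₀ hU₀ α₀ hα hAK hs GB SC2
  refine G η hη c SC4 U₀ hU₀ α₀ hα hAK hs (wPrinted d' ℓ η) (fun j => ((wPrinted_facts d' hℓ hη).1 j).le) ?_ SC2
  -- the REAL block of p557429 at `w := wPrinted`, from F8 at this cube datum and truncation
  intro n hn hnk S hS B hB K hK T hT Q hQ
  have hρpos : 0 < c.ρ := lt_of_lt_of_le (by omega) c.L_le_ρ
  have hM0' : M₀ ≤ ((ℓ : ℝ) + 1) * Mh := by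
    have : ((ℓ + 1 : ℕ) : ℝ) = (ℓ : ℝ) + 1 := by push_cast; ring
    rw [← this]; exact hM0
  obtain ⟨h1, h2, h3⟩ := F8 η hη Mh hMh hM0' c.a c.M c.ρ c.k n R hn hnk hρd hMd hρpos hR hR2 hRN hρ0 S hS B hB K hK
    T hT Q hQ CG hCG (GB n hn hnk S hS B hB K hK T hT Q hQ)
  refine ⟨h1, fun X s hs hXs φ hφ0 hφS => ?_, h3⟩
  obtain ⟨hf, hg, hΔ⟩ := h2 X s hs hXs φ hφ0 hφS
  have hmono : BG * (BG' * CG) * s ≤ (BG * (BG' * CG) + BG) * s := by nlinarith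
  exact ⟨fun x => (hf x).trans hmono, fun j hj p hp => (hg j hj p hp).trans hmono, hΔ⟩

#print axioms gaugedBoundB8_cubeMember_scalar_γ_of_gboundAt

/-! ## §2 The same with the 𝒢-bound NAMED: `GBoundCubeMemberPrinted (d − 1) (L − 1)` -/

open Classical in
/-- ★ **PROPOSITION 6 AT A CUBE OF PRINT'S BIG-BLOCK SUB-LATTICE FROM THE TWO SCALAR FLAT γ CLAUSES, CONDITIONAL ON THE NAMED 𝒢-BOUND**
`GBoundCubeMemberPrinted (d − 1) (L − 1)` ([4] Theorem 3.2 (3.48) at `U = 1` on the cube member, dag-n05-c F10; OPEN in the tree): the flat p6 letter whose only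
per-cube hypotheses are the SCALAR four-line γ clause at the top truncation and the SCALAR two-line γ clause at every truncation — the three REAL families of
p557429 discharged by name.  Side conditions of p. 98 displayed; thresholds merged with the named fact's.  CONDITIONAL (the gate records it).
[cite: Balaban1985RegularSpaces, Prop. 6 (1.135)–(1.138) p.99, p.98, Thm 4 p.88, Prop. 3 p.87, (1.59) p.86, (1.31) p.82; Balaban1985BackgroundPropagators, Thm 3.2 (3.48) p.398, Thm 3.3 p.399] -/
theorem gaugedBoundB8_cubeMember_scalar_γ_of_GBound (hd2 : 2 ≤ d) {L : ℕ} (hL : 2 ≤ L) {B₀ Bbd : ℝ} (hB₀ : 0 < B₀)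
    (hB : 2 ≤ 5 * (d : ℝ) * L * B₀) (hBbd : 0 ≤ Bbd) (hBd : 4 * Bbd ≤ ((d : ℝ) * L - 1) * B₀)
    (hG : GBoundCubeMemberPrinted (d - 1) (L - 1)) :
    ∃ c₁ ρ₀ M₀ : ℝ, ∃ N₀ : ℕ, 0 < c₁ ∧ ∀ (η : ℝ), 0 < η → ∀ {K : ℕ} {Ω : ℕ → Set (Site d)} (c : CubeB8 d L K Ω),
      -- PRINT'S SIDE CONDITIONS (p. 98) on the cube datum, above threshold
      ∀ (Mh R : ℕ), 3 ≤ Mh → M₀ ≤ (L : ℝ) * Mh → Mh * L ∣ c.ρ → Mh * L ∣ c.M → R * (Mh * L) ≤ c.ρ → 2 * L ≤ R →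
        N₀ + 1 ≤ R * (L * Mh) → ρ₀ ≤ (c.ρ : ℝ) →
      -- THE SCALAR FLAT FOUR-LINE (1.59) CLAUSE OF PROPOSITION 3's FRAME at the cube's top truncation `c.k`: ℂ-valued bond functions in the
      -- flat Landau gauge on the collars of `{□_j}`, exterior-collar allowance on each line ([4] Thm 3.3 at `U = 1` for `G(1)`, `H(1)`, a priori)
      (∀ φ : Site d → Fin d → ℂ,
        IsLandau138 L c.k η (cubeFam false L c.a c.M c.ρ c.k 0) (cubeLamS L c.a c.M c.ρ c.k c.k) (1 : Site d → Fin d → ℂˣ) φ →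
        (∀ (y : Site d) (τ : Fin d), (∀ j, j ≤ c.k → ¬ SideTouches (cubeFam false L c.a c.M c.ρ c.k j) y τ) → φ y τ = 0) →
        msup L c.k η (-(1 : ℝ)) (fun j (b : Site d × Fin d) => SideTouches (cubeFam false L c.a c.M c.ρ c.k j) b.1 b.2) (fun b => φ b.1 b.2)
          ≤ B₀ * (bondNorm L c.k η (-(3 : ℝ)) (cubeFam false L c.a c.M c.ρ c.k) (fun x μ => Jcur η (1 : Site d → Fin d → ℂˣ) φ μ x)
            + wsup 1 (fun p : {p : ℕ × (Site d × Fin d) // p.1 ≤ c.k ∧ (p.2 ∈ cubeLamBP' L c.a c.M c.ρ c.k c.k p.1 ∨ (p.1 = 0 ∧ CrossB ((cubeFam false L c.a c.M c.ρ c.k) 0) p.2))} =>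
                linCovIter L (1 : Site d → Fin d → ℂˣ) (iEta η φ) p.1.1 p.1.2.1 p.1.2.2))
            + Bbd * msup L c.k η (-(1 : ℝ)) (fun j (b : Site d × Fin d) => j = 0 ∧ SideTouches (cubeFam false L c.a c.M c.ρ c.k 0) b.1 b.2 ∧
                ¬ BondTouches (cubeFam false L c.a c.M c.ρ c.k 0) b.1 b.2) (fun b => φ b.1 b.2) ∧
        msup L c.k η (-(2 : ℝ)) (fun j (t : Fin d × Fin d × Site d) => SideTouches (cubeFam false L c.a c.M c.ρ c.k j) t.2.2 t.2.1)
            (fun t => covDerivFwd η (1 : Site d → Fin d → ℂˣ) t.1 (fun z => φ z t.2.1) t.2.2)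
          ≤ B₀ * (bondNorm L c.k η (-(3 : ℝ)) (cubeFam false L c.a c.M c.ρ c.k) (fun x μ => Jcur η (1 : Site d → Fin d → ℂˣ) φ μ x)
            + wsup 1 (fun p : {p : ℕ × (Site d × Fin d) // p.1 ≤ c.k ∧ (p.2 ∈ cubeLamBP' L c.a c.M c.ρ c.k c.k p.1 ∨ (p.1 = 0 ∧ CrossB ((cubeFam false L c.a c.M c.ρ c.k) 0) p.2))} =>
                linCovIter L (1 : Site d → Fin d → ℂˣ) (iEta η φ) p.1.1 p.1.2.1 p.1.2.2))
            + Bbd * msup L c.k η (-(1 : ℝ)) (fun j (b : Site d × Fin d) => j = 0 ∧ SideTouches (cubeFam false L c.a c.M c.ρ c.k 0) b.1 b.2 ∧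
                ¬ BondTouches (cubeFam false L c.a c.M c.ρ c.k 0) b.1 b.2) (fun b => φ b.1 b.2) ∧
        bondNorm L c.k η (-(3 : ℝ)) (cubeFam false L c.a c.M c.ρ c.k) (fun x μ => pdiv η (1 : Site d → Fin d → ℂˣ) (plaqCovDeriv η (1 : Site d → Fin d → ℂˣ) φ) μ x)
          ≤ B₀ * (bondNorm L c.k η (-(3 : ℝ)) (cubeFam false L c.a c.M c.ρ c.k) (fun x μ => Jcur η (1 : Site d → Fin d → ℂˣ) φ μ x)
            + wsup 1 (fun p : {p : ℕ × (Site d × Fin d) // p.1 ≤ c.k ∧ (p.2 ∈ cubeLamBP' L c.a c.M c.ρ c.k c.k p.1 ∨ (p.1 = 0 ∧ CrossB ((cubeFam false L c.a c.M c.ρ c.k) 0) p.2))} =>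
                linCovIter L (1 : Site d → Fin d → ℂˣ) (iEta η φ) p.1.1 p.1.2.1 p.1.2.2))
            + Bbd * msup L c.k η (-(1 : ℝ)) (fun j (b : Site d × Fin d) => j = 0 ∧ SideTouches (cubeFam false L c.a c.M c.ρ c.k 0) b.1 b.2 ∧
                ¬ BondTouches (cubeFam false L c.a c.M c.ρ c.k 0) b.1 b.2) (fun b => φ b.1 b.2) ∧
        bondNorm L c.k η (-(3 : ℝ)) (cubeFam false L c.a c.M c.ρ c.k) (fun x μ => covLap η (1 : Site d → Fin d → ℂˣ) (fun z => φ z μ) x)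
          ≤ B₀ * (bondNorm L c.k η (-(3 : ℝ)) (cubeFam false L c.a c.M c.ρ c.k) (fun x μ => Jcur η (1 : Site d → Fin d → ℂˣ) φ μ x)
            + wsup 1 (fun p : {p : ℕ × (Site d × Fin d) // p.1 ≤ c.k ∧ (p.2 ∈ cubeLamBP' L c.a c.M c.ρ c.k c.k p.1 ∨ (p.1 = 0 ∧ CrossB ((cubeFam false L c.a c.M c.ρ c.k) 0) p.2))} =>
                linCovIter L (1 : Site d → Fin d → ℂˣ) (iEta η φ) p.1.1 p.1.2.1 p.1.2.2))
            + Bbd * msup L c.k η (-(1 : ℝ)) (fun j (b : Site d × Fin d) => j = 0 ∧ SideTouches (cubeFam false L c.a c.M c.ρ c.k 0) b.1 b.2 ∧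
                ¬ BondTouches (cubeFam false L c.a c.M c.ρ c.k 0) b.1 b.2) (fun b => φ b.1 b.2)) →
      ∀ (U₀ : Site d → Fin d → 𝔸ˣ), (∀ x κ, U₀ x κ ∈ unitaryUnits 𝔸) → ∀ (α₀ : ℝ), 0 < α₀ → InAk L K η α₀ Ω U₀ →
      7 * d * (L : ℝ) ^ 2 * c.M * α₀ ≤ c₁ →
      -- THE SCALAR FLAT TWO-LINE (1.59) CLAUSE OF THEOREM 4's FRAME at every truncation `m ≤ c.k` (ℂ-valued, flat Landau gauge, collar allowance)
      (∀ m, 1 ≤ m → m ≤ c.k → ∀ φ : Site d → Fin d → ℂ,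
        IsLandau138 L m η ((cubeFam false L c.a c.M c.ρ c.k) 0) ((cubeLamS L c.a c.M c.ρ c.k) m) (1 : Site d → Fin d → ℂˣ) φ →
        (∀ (y : Site d) (τ : Fin d), (∀ j, j ≤ m → ¬ SideTouches ((cubeFam false L c.a c.M c.ρ c.k) j) y τ) → φ y τ = 0) →
        msup L m η (-(1 : ℝ)) (fun j (b : Site d × Fin d) => SideTouches ((cubeFam false L c.a c.M c.ρ c.k) j) b.1 b.2) (fun b => φ b.1 b.2)
          ≤ B₀ * (bondNorm L m η (-(3 : ℝ)) (cubeFam false L c.a c.M c.ρ c.k) (fun x μ => Jcur η (1 : Site d → Fin d → ℂˣ) φ μ x)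
            + wsup 1 (fun p : {p : ℕ × (Site d × Fin d) // p.1 ≤ m ∧ (p.2 ∈ (cubeLamBP' L c.a c.M c.ρ c.k) m p.1 ∨ (p.1 = 0 ∧ CrossB ((cubeFam false L c.a c.M c.ρ c.k) 0) p.2))} =>
                linCovIter L (1 : Site d → Fin d → ℂˣ) (iEta η φ) p.1.1 p.1.2.1 p.1.2.2))
            + Bbd * msup L m η (-(1 : ℝ)) (fun j (b : Site d × Fin d) => j = 0 ∧ SideTouches ((cubeFam false L c.a c.M c.ρ c.k) 0) b.1 b.2 ∧
                ¬ BondTouches ((cubeFam false L c.a c.M c.ρ c.k) 0) b.1 b.2) (fun b => φ b.1 b.2) ∧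
        msup L m η (-(2 : ℝ)) (fun j (t : Fin d × Fin d × Site d) => SideTouches ((cubeFam false L c.a c.M c.ρ c.k) j) t.2.2 t.2.1)
            (fun t => covDerivFwd η (1 : Site d → Fin d → ℂˣ) t.1 (fun z => φ z t.2.1) t.2.2)
          ≤ B₀ * (bondNorm L m η (-(3 : ℝ)) (cubeFam false L c.a c.M c.ρ c.k) (fun x μ => Jcur η (1 : Site d → Fin d → ℂˣ) φ μ x)
            + wsup 1 (fun p : {p : ℕ × (Site d × Fin d) // p.1 ≤ m ∧ (p.2 ∈ (cubeLamBP' L c.a c.M c.ρ c.k) m p.1 ∨ (p.1 = 0 ∧ CrossB ((cubeFam false L c.a c.M c.ρ c.k) 0) p.2))} =>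
                linCovIter L (1 : Site d → Fin d → ℂˣ) (iEta η φ) p.1.1 p.1.2.1 p.1.2.2))
            + Bbd * msup L m η (-(1 : ℝ)) (fun j (b : Site d × Fin d) => j = 0 ∧ SideTouches ((cubeFam false L c.a c.M c.ρ c.k) 0) b.1 b.2 ∧
                ¬ BondTouches ((cubeFam false L c.a c.M c.ρ c.k) 0) b.1 b.2) (fun b => φ b.1 b.2)) →
      GaugedBoundB8 L η U₀ c (7 * d * (L : ℝ) ^ 2 * (5 * (d : ℝ) * L * B₀) * c.M * α₀) := by
  -- unpack the named fact at `(d − 1, L − 1) = (d', ℓ)`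
  obtain ⟨d', rfl⟩ : ∃ d', d = d' + 1 := ⟨d - 1, by omega⟩
  obtain ⟨ℓ, rfl⟩ : ∃ ℓ, L = ℓ + 1 := ⟨L - 1, by omega⟩
  obtain ⟨CG, ρG, MG, NG, hCG, hGb⟩ := hG
  obtain ⟨c₁, ρ₀, M₀, N₀, hc₁, H⟩ :=
    gaugedBoundB8_cubeMember_scalar_γ_of_gboundAt (𝔸 := 𝔸) hd2 hL hB₀ hB hBbd hBd hCG
  refine ⟨c₁, max ρ₀ ρG, max M₀ MG, max N₀ NG, hc₁, ?_⟩
  intro η hη K Ω c Mh R hMh hM0 hρd hMd hR hR2 hRN hρ0 SC4 U₀ hU₀ α₀ hα hAK hs SC2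
  have hM01 : M₀ ≤ ((ℓ + 1 : ℕ) : ℝ) * Mh := (le_max_left _ _).trans hM0
  have hM02 : MG ≤ ((ℓ : ℝ) + 1) * Mh := by
    have : ((ℓ + 1 : ℕ) : ℝ) = (ℓ : ℝ) + 1 := by push_cast; ring
    rw [← this]; exact (le_max_right _ _).trans hM0
  have hRN1 : N₀ + 1 ≤ R * ((ℓ + 1) * Mh) := le_trans (Nat.add_le_add_right (le_max_left _ _) 1) hRN
  have hRN2 : NG + 1 ≤ R * ((ℓ + 1) * Mh) := le_trans (Nat.add_le_add_right (le_max_right _ _) 1) hRN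
  have hρ1 : ρ₀ ≤ (c.ρ : ℝ) := (le_max_left _ _).trans hρ0
  have hρ2 : ρG ≤ (c.ρ : ℝ) := (le_max_right _ _).trans hρ0
  have hρpos : 0 < c.ρ := lt_of_lt_of_le (by omega) c.L_le_ρ
  refine H η hη c Mh R hMh hM01 hρd hMd hR hR2 hRN1 hρ1 SC4 U₀ hU₀ α₀ hα hAK hs ?_ SC2
  -- the displayed 𝒢-bound at this cube from the named fact
  intro n hn hnk S hS B hB K hK T hT Q hQ X s hs hXs p
  exact hGb η hη Mh hMh hM02 c.a c.M c.ρ c.k n R hn hnk hρd hMd hρpos hR hR2 hRN2 hρ2 S hS B hB K hK T hT Q hQ X s hs hXs p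

#print axioms gaugedBoundB8_cubeMember_scalar_γ_of_GBound

end Literature.MathematicalPhysics.QuantumFieldTheory.Balaban1983to89.B8Prop6CubeMemberScalarGammaOfGBound

end
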